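import Mathlib

/-!
# Route BarrierLever — item `PartitionMinorsHitByVP` (stmt-ValiantsHypothesis-19717):
# the SUBSET-SUM MULTILINEAR VANDERMONDE is nonsingular on every SPLITTABLE row family

Helper file (`--supports stmt-ValiantsHypothesis-19717`; cell valiant-natproofs, rung V4, 𝒟-side door (c),
prover seat val-np-p1). Closes NO item; pure linear algebra, no circuits.

**Setting.** The layout-adaptive witness family `F_Γ = E₀(y) · ∏_k (1 + x_k · ∏_c (1 + Γ_{kc} y_c))`
(memo `F2-MEMO-valnp1-g9.md`, evidence on item 19717) has partition matrix
`M[U, W] = ∏_{c ∈ W} (Γ₀_c + Σ_{k ∈ U} Γ_{kc})` — a generalized multilinear VANDERMONDE evaluated at the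
subset-sum points `z_U = Γ₀ + Σ_{k∈U} Γ_k`.  On a FACE of column sets (all `W ⊆ T`, `|T| = κ`, after
relabelling `T ≃ Fin κ`) and any family of `2^κ` row sets this is the square matrix

  `ssv κ u : (Fin κ → Bool) × (Fin κ → Bool) → R`,  `(i, W) ↦ ∏_{c : W c} (X_(c,none) + Σ_{k ∈ u i} X_(c, some k))`

over the polynomial ring `R = ℂ[X_(c,none), X_(c,some k)]` (rows `u i ⊆ Fin h` indexed by bit-vectors
`i`, columns = bit-vectors `W`).

**Theorem (`SubsetSum.det_ssv_ne_zero`).** If the row family `{u i}` is SPLITTABLE of depth `κ` — recursively: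
some affine functional `U ↦ Σ_{k∈U} a_k − t` vanishes on exactly a sub-family `Z` and both `Z` and its
complement are splittable of depth `κ − 1` (depth `0` = one set) — then `det (ssv κ u) ≠ 0` in `R`.
*Proof.* Block-triangular induction («fiber lemma»): specialising the coordinate-`0` variables to the
splitting functional (`X_(0,none) ↦ −t`, `X_(0,some k) ↦ a_k`) kills the block (rows in `Z`) × (columns
containing `0`); after reindexing rows by `Z ⊕ Zᶜ` and columns by `0 ∉ W ⊕ 0 ∈ W` the specialised matrix
is `fromBlocks (ssv u₀) 0 _ (diagonal s · ssv u₁)` with `s ≠ 0` pointwise, so its determinant is the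
product of the two smaller ones (induction) and of `∏ s ≠ 0`; a ring map cannot send a zero determinant
to a nonzero one.

**Corollary (`SubsetSum.exists_det_ne_zero`).** Under the same hypothesis there are NUMERIC `Γ₀ : Fin κ → ℂ`,
`Γ : Fin h → Fin κ → ℂ` with `det[∏_{c : W c} (Γ₀ c + Σ_{k∈u i} Γ k c)]_{i,W} ≠ 0` (`MvPolynomial.funext`).

Companion statements (memo §3): every family of `2^κ` subsets of `Fin h` is expected to be splittable
(«HALVING LEMMA»: a `2^κ`-subset of `{0,1}^h` has a rational affine section of exactly half; verified for all
subsets of `{0,1}^4`, sampled in `{0,1}^5`, `{0,1}^6` — kit j271111); with it, this file gives item 19717 on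
all «arbitrary rows × face columns» layouts. WHAT THIS IS NOT: no circuit is built here (the witness and its
`SmallCircuits` membership are a separate file); nothing on columns that are not a face; nothing on crux 14610.
-/

set_option linter.dupNamespace false

namespace Summit.ValiantsHypothesis.ValiantsHypothesis.Theorems.BarrierLever.SubsetSum

open Finset MvPolynomial Matrix

noncomputable section

variable {h : ℕ}

/-! ## 1. IsSplittable families -/

/-- A family `𝒰` of subsets of `Fin h` is SPLITTABLE of depth `κ`: depth `0` means a single set; depth
`κ + 1` means some affine functional `U ↦ Σ_{k ∈ U} a k` takes the value `t` on exactly a sub-family `Z`,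
and both `Z` and `𝒰 \ Z` are splittable of depth `κ`. -/
def IsSplittable : ℕ → Finset (Finset (Fin h)) → Prop
  | 0, 𝒰 => 𝒰.card = 1
  | κ + 1, 𝒰 => ∃ Z : Finset (Finset (Fin h)), Z ⊆ 𝒰 ∧
      (∃ (a : Fin h → ℂ) (t : ℂ), ∀ U ∈ 𝒰, (∑ k ∈ U, a k = t ↔ U ∈ Z)) ∧
      IsSplittable κ Z ∧ IsSplittable κ (𝒰 \ Z)

/-- A splittable family of depth `κ` has exactly `2 ^ κ` members. -/
theorem IsSplittable.card_eq : ∀ {κ : ℕ} {𝒰 : Finset (Finset (Fin h))}, IsSplittable κ 𝒰 → 𝒰.card = 2 ^ κ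
  | 0, _, hs => by simpa [IsSplittable] using hs
  | κ + 1, 𝒰, hs => by
    obtain ⟨Z, hZ, -, hsZ, hsC⟩ := hs
    have h1 := IsSplittable.card_eq hsZ
    have h2 := IsSplittable.card_eq hsC
    have := Finset.card_sdiff_add_card_eq_card hZ
    rw [pow_succ]
    omega

/-! ## 2. The symbolic subset-sum Vandermonde matrix -/

/-- The polynomial ring `ℂ[X_(c, none), X_(c, some k) : c < κ, k < h]` (`none` = the affine shift `Γ₀`). -/
abbrev R (κ h : ℕ) := MvPolynomial (Fin κ × Option (Fin h)) ℂ

/-- The symbolic `c`-th coordinate of the subset-sum point of `U`: `X_(c,none) + Σ_{k ∈ U} X_(c, some k)`. -/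
def lin (κ : ℕ) (c : Fin κ) (U : Finset (Fin h)) : R κ h :=
  X (c, none) + ∑ k ∈ U, X (c, some k)

/-- The symbolic subset-sum multilinear Vandermonde matrix of a row family `u` indexed by bit-vectors:
entry `(i, W) = ∏_{c : W c} lin c (u i)`. -/
def ssv (κ : ℕ) (u : (Fin κ → Bool) → Finset (Fin h)) :
    Matrix (Fin κ → Bool) (Fin κ → Bool) (R κ h) :=
  fun i W => ∏ c : Fin κ, if W c then lin κ c (u i) else 1

/-! ## 3. The specialisation of coordinate `0` -/

/-- Substitution: coordinate-`0` variables become the constants of the splitting functional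
(`X_(0,none) ↦ −t`, `X_(0,some k) ↦ a k`); coordinate `c+1` becomes coordinate `c`. -/
def spec (κ : ℕ) (a : Fin h → ℂ) (t : ℂ) : Fin (κ + 1) × Option (Fin h) → R κ h :=
  fun p => Fin.cases (motive := fun _ => R κ h)
    (C (Option.elim p.2 (-t) a)) (fun c' => X (c', p.2)) p.1

/-- `spec` on coordinate `0`: the constants of the splitting functional. -/
theorem spec_zero (κ : ℕ) (a : Fin h → ℂ) (t : ℂ) (o : Option (Fin h)) :
    spec κ a t (0, o) = C (Option.elim o (-t) a) := by
  simp [spec]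

/-- `spec` on coordinate `c + 1`: the variable of coordinate `c`. -/
theorem spec_succ (κ : ℕ) (a : Fin h → ℂ) (t : ℂ) (c : Fin κ) (o : Option (Fin h)) :
    spec κ a t (Fin.succ c, o) = X (c, o) := by
  simp [spec]

/-- The specialisation map `φ = aeval (spec a t)`. -/
def φ (κ : ℕ) (a : Fin h → ℂ) (t : ℂ) : R (κ + 1) h →ₐ[ℂ] R κ h := aeval (spec κ a t)

/-- `φ` sends the coordinate-`0` form of `U` to the scalar `−t + Σ_{k ∈ U} a k`. -/
theorem φ_lin_zero (κ : ℕ) (a : Fin h → ℂ) (t : ℂ) (U : Finset (Fin h)) :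
    φ κ a t (lin (κ + 1) 0 U) = C (-t + ∑ k ∈ U, a k) := by
  simp only [φ, lin, map_add, map_sum, aeval_X, spec_zero, Option.elim]

/-- `φ` sends the coordinate-`(c+1)` form to the coordinate-`c` form. -/
theorem φ_lin_succ (κ : ℕ) (a : Fin h → ℂ) (t : ℂ) (c : Fin κ) (U : Finset (Fin h)) :
    φ κ a t (lin (κ + 1) (Fin.succ c) U) = lin κ c U := by
  simp only [φ, lin, map_add, map_sum, aeval_X, spec_succ]

/-- Entries of the specialised matrix: the coordinate-`0` factor becomes the scalar `−t + Σ a`. -/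
theorem φ_ssv_apply (κ : ℕ) (a : Fin h → ℂ) (t : ℂ) (u : (Fin (κ + 1) → Bool) → Finset (Fin h))
    (i W : Fin (κ + 1) → Bool) :
    φ κ a t (ssv (κ + 1) u i W) =
      (if W 0 then C (-t + ∑ k ∈ u i, a k) else 1) *
        ∏ c : Fin κ, if W (Fin.succ c) then lin κ c (u i) else 1 := by
  simp only [ssv, map_prod]
  rw [Fin.prod_univ_succ]
  congr 1
  · split_ifs <;> simp [φ_lin_zero]
  · refine Finset.prod_congr rfl fun c _ => ?_
    split_ifs <;> simp [φ_lin_succ]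

/-! ## 4. Reindexing bookkeeping -/

/-- Columns: a bit-vector on `Fin (κ+1)` is its head bit and its tail. -/
def colEquiv (κ : ℕ) : ((Fin κ → Bool) ⊕ (Fin κ → Bool)) ≃ (Fin (κ + 1) → Bool) :=
  (Equiv.boolProdEquivSum _).symm.trans (Fin.consEquiv fun _ => Bool)

/-- Left summand = bit-vectors with head `false`. -/
@[simp] theorem colEquiv_inl (κ : ℕ) (j : Fin κ → Bool) :
    colEquiv κ (Sum.inl j) = Fin.cons false j := by
  simp [colEquiv, Equiv.boolProdEquivSum, Fin.consEquiv]

/-- Right summand = bit-vectors with head `true`. -/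
@[simp] theorem colEquiv_inr (κ : ℕ) (j : Fin κ → Bool) :
    colEquiv κ (Sum.inr j) = Fin.cons true j := by
  simp [colEquiv, Equiv.boolProdEquivSum, Fin.consEquiv]

/-- If `det (M.submatrix θ δ) ≠ 0` for equivalences `θ, δ`, then `det M ≠ 0`. -/
theorem det_ne_zero_of_submatrix {m n : Type*} [Fintype m] [Fintype n] [DecidableEq m] [DecidableEq n]
    {S : Type*} [CommRing S] (M : Matrix n n S) (θ δ : m ≃ n)
    (hM : (M.submatrix θ δ).det ≠ 0) : M.det ≠ 0 := by
  intro h0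
  apply hM
  have key : M.submatrix θ δ = (M.submatrix θ θ).submatrix id (δ.trans θ.symm) := by
    ext a b
    simp [Matrix.submatrix_apply]
  rw [key, Matrix.det_permute', Matrix.det_submatrix_equiv_self, h0, mul_zero]

/-! ## 5. The engine -/

/-- Cardinality of the bit-vector index type. -/
theorem card_bv (κ : ℕ) : Fintype.card (Fin κ → Bool) = 2 ^ κ := by
  simp

/-- **Engine.** The symbolic subset-sum Vandermonde of a splittable family is nonsingular. -/
theorem det_ssv_ne_zero : ∀ (κ : ℕ) (u : (Fin κ → Bool) → Finset (Fin h)),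
    Function.Injective u → IsSplittable κ (univ.image u) → (ssv κ u).det ≠ 0
  | 0, u, _, _ => by
    rw [Matrix.det_unique]
    simp [ssv]
  | κ + 1, u, hu, hs => by
    obtain ⟨Z, hZ, ⟨a, t, hat⟩, hsZ, hsC⟩ := hs
    -- the scalar of row `i` under the specialisation, zero exactly on `Z`
    set s : (Fin (κ + 1) → Bool) → ℂ := fun i => -t + ∑ k ∈ u i, a k with hs_def
    have hs_iff : ∀ i, s i = 0 ↔ u i ∈ Z := fun i => by
      rw [hs_def]
      simp only
      rw [neg_add_eq_zero, eq_comm]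
      exact hat (u i) (mem_image_of_mem u (mem_univ i))
    -- the row split
    let pZ : (Fin (κ + 1) → Bool) → Prop := fun i => u i ∈ Z
    have hcardZ : Fintype.card {i // pZ i} = Fintype.card (Fin κ → Bool) := by
      have himg : (univ.filter fun i => pZ i).image u = Z := by
        ext U
        simp only [mem_image, mem_filter, mem_univ, true_and, pZ]
        constructor
        · rintro ⟨i, hi, rfl⟩; exact hi
        · intro hU
          obtain ⟨i, -, rfl⟩ := mem_image.mp (hZ hU)
          exact ⟨i, hU, rfl⟩
      have hci := card_image_of_injective (univ.filter fun i => pZ i) hu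
      rw [himg, hsZ.card_eq] at hci
      rw [Fintype.card_subtype, card_bv]
      exact hci.symm
    have hcardC : Fintype.card {i // ¬ pZ i} = Fintype.card (Fin κ → Bool) := by
      rw [Fintype.card_subtype_compl, hcardZ, card_bv, card_bv, pow_succ]
      omega
    let e₀ : {i // pZ i} ≃ (Fin κ → Bool) := Fintype.equivOfCardEq hcardZ
    let e₁ : {i // ¬ pZ i} ≃ (Fin κ → Bool) := Fintype.equivOfCardEq hcardC
    -- the two half families
    let u₀ : (Fin κ → Bool) → Finset (Fin h) := fun j => u (e₀.symm j).1
    let u₁ : (Fin κ → Bool) → Finset (Fin h) := fun j => u (e₁.symm j).1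
    have hu₀ : Function.Injective u₀ := fun j j' hjj' =>
      e₀.symm.injective (Subtype.ext (hu hjj'))
    have hu₁ : Function.Injective u₁ := fun j j' hjj' =>
      e₁.symm.injective (Subtype.ext (hu hjj'))
    have himg₀ : univ.image u₀ = Z := by
      ext U
      simp only [mem_image, mem_univ, true_and, u₀]
      constructor
      · rintro ⟨j, rfl⟩; exact (e₀.symm j).2
      · intro hU
        obtain ⟨i, -, rfl⟩ := mem_image.mp (hZ hU)
        exact ⟨e₀ ⟨i, hU⟩, by simp⟩
    have himg₁ : univ.image u₁ = univ.image u \ Z := by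
      ext U
      simp only [mem_image, mem_univ, true_and, u₁, mem_sdiff]
      constructor
      · rintro ⟨j, rfl⟩; exact ⟨⟨_, rfl⟩, (e₁.symm j).2⟩
      · rintro ⟨⟨i, rfl⟩, hU⟩
        exact ⟨e₁ ⟨i, hU⟩, by simp⟩
    have IH₀ : (ssv κ u₀).det ≠ 0 := det_ssv_ne_zero κ u₀ hu₀ (himg₀ ▸ hsZ)
    have IH₁ : (ssv κ u₁).det ≠ 0 := det_ssv_ne_zero κ u₁ hu₁ (himg₁ ▸ hsC)
    -- the specialised matrix and its block form
    set M' : Matrix (Fin (κ + 1) → Bool) (Fin (κ + 1) → Bool) (R κ h) :=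
      (φ κ a t).toRingHom.mapMatrix (ssv (κ + 1) u) with hM'
    let θ : ((Fin κ → Bool) ⊕ (Fin κ → Bool)) ≃ (Fin (κ + 1) → Bool) :=
      (Equiv.sumCongr e₀.symm e₁.symm).trans (Equiv.sumCompl pZ)
    have hθl : ∀ j, θ (Sum.inl j) = (e₀.symm j).1 := fun j => by
      simp [θ, Equiv.sumCompl_apply_inl]
    have hθr : ∀ j, θ (Sum.inr j) = (e₁.symm j).1 := fun j => by
      simp [θ, Equiv.sumCompl_apply_inr]
    let d : (Fin κ → Bool) → R κ h := fun j => C (s (e₁.symm j).1)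
    have hblock : M'.submatrix θ (colEquiv κ) =
        Matrix.fromBlocks (ssv κ u₀) 0 (ssv κ u₁) (Matrix.diagonal d * ssv κ u₁) := by
      ext x y
      rcases x with i | i <;> rcases y with j | j
      · simp only [Matrix.submatrix_apply, hθl, colEquiv_inl, Matrix.fromBlocks_apply₁₁, hM',
          RingHom.mapMatrix_apply, Matrix.map_apply, AlgHom.toRingHom_eq_coe, RingHom.coe_coe,
          φ_ssv_apply, Fin.cons_zero, Fin.cons_succ]
        simp [ssv, u₀]
      · simp only [Matrix.submatrix_apply, hθl, colEquiv_inr, Matrix.fromBlocks_apply₁₂, hM',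
          RingHom.mapMatrix_apply, Matrix.map_apply, AlgHom.toRingHom_eq_coe, RingHom.coe_coe,
          φ_ssv_apply, Fin.cons_zero, Fin.cons_succ, if_true, Matrix.zero_apply]
        have : s (e₀.symm i).1 = 0 := (hs_iff _).mpr (e₀.symm i).2
        rw [show (-t + ∑ k ∈ u (e₀.symm i).1, a k) = s (e₀.symm i).1 from rfl, this]
        simp
      · simp only [Matrix.submatrix_apply, hθr, colEquiv_inl, Matrix.fromBlocks_apply₂₁, hM',
          RingHom.mapMatrix_apply, Matrix.map_apply, AlgHom.toRingHom_eq_coe, RingHom.coe_coe,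
          φ_ssv_apply, Fin.cons_zero, Fin.cons_succ]
        simp [ssv, u₁]
      · simp only [Matrix.submatrix_apply, hθr, colEquiv_inr, Matrix.fromBlocks_apply₂₂, hM',
          RingHom.mapMatrix_apply, Matrix.map_apply, AlgHom.toRingHom_eq_coe, RingHom.coe_coe,
          φ_ssv_apply, Fin.cons_zero, Fin.cons_succ, if_true, Matrix.diagonal_mul]
        simp [ssv, u₁, d, hs_def]
    -- the determinant of the block form is nonzero
    have hd : ∀ j, d j ≠ 0 := fun j => by
      simp only [d, ne_eq, C_eq_zero]
      exact fun h0 => (e₁.symm j).2 ((hs_iff _).mp h0)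
    have hdet_block : (M'.submatrix θ (colEquiv κ)).det ≠ 0 := by
      rw [hblock, Matrix.det_fromBlocks_zero₁₂, Matrix.det_mul, Matrix.det_diagonal]
      exact mul_ne_zero IH₀ (mul_ne_zero (prod_ne_zero_iff.mpr fun j _ => hd j) IH₁)
    have hdetM' : M'.det ≠ 0 := det_ne_zero_of_submatrix M' θ (colEquiv κ) hdet_block
    -- pull back along the specialisation
    intro h0
    apply hdetM'
    rw [hM', ← RingHom.map_det, h0, map_zero]

/-! ## 6. Numeric corollary -/

/-- **Numeric subset-sum Vandermonde.** For a splittable family there are numbers `Γ₀, Γ` making the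
multilinear Vandermonde at the subset-sum points `Γ₀ + Σ_{k ∈ u i} Γ k` (rows `i`, columns = all subsets
`W` of the `κ` coordinates) nonsingular. -/
theorem exists_det_ne_zero (κ : ℕ) (u : (Fin κ → Bool) → Finset (Fin h)) (hu : Function.Injective u)
    (hs : IsSplittable κ (univ.image u)) :
    ∃ (Γ₀ : Fin κ → ℂ) (Γ : Fin h → Fin κ → ℂ),
      (Matrix.of fun i W : Fin κ → Bool =>
        ∏ c : Fin κ, if W c then (Γ₀ c + ∑ k ∈ u i, Γ k c) else (1 : ℂ)).det ≠ 0 := by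
  have hne := det_ssv_ne_zero κ u hu hs
  -- some evaluation of the nonzero polynomial `det (ssv κ u)` is nonzero
  have : ∃ x : Fin κ × Option (Fin h) → ℂ, eval x (ssv κ u).det ≠ 0 := by
    by_contra hcon
    push Not at hcon
    exact hne (MvPolynomial.funext fun x => by rw [hcon x, map_zero])
  obtain ⟨x, hx⟩ := this
  refine ⟨fun c => x (c, none), fun k c => x (c, some k), ?_⟩
  rw [RingHom.map_det] at hx
  convert hx using 2
  ext i W
  simp only [Matrix.of_apply, RingHom.mapMatrix_apply, Matrix.map_apply, ssv, map_prod]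
  refine Finset.prod_congr rfl fun c _ => ?_
  split_ifs
  · simp [lin, map_add, map_sum, eval_X]
  · simp

end

end Summit.ValiantsHypothesis.ValiantsHypothesis.Theorems.BarrierLever.SubsetSum
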